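import Literature.Algebra.Lie.LefschetzModuleHorizontalSubalgebra
import Literature.Algebra.Lie.LefschetzStringInvariantForm
import Literature.LinearAlgebra.EndomorphismBicommutant
import HarnessLib

/-!
# Highest weight vectors in `𝔤𝔩(V(d))`: Looijenga–Lunts 1997, Appendix, Lemma (7.1)

Topic `Literature/Algebra/Lie` (namespace `Literature.Algebra.Lie`).  Lane `lit-hodgefound` (Track 2 foundations
library), skeleton seat `lit-hodgefound-skel-1` (generation 47), row **A1-153** of
`run/shared/lean/pub/lit-hodgefound/SKELETON.md`: the key step of the Lemma opening Looijenga–Lunts' Appendix (and of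
the proof of (1.15)) — in the standard irreducible `𝔰𝔩₂`-module `V(d)`, a "monic `K[e]`-module", every transformation
`T` with `[e, T] = 0` and `[h, T] = m T` is proportional to `e^{m/2}`; the powers `e^i` are coprimitive of weight `2i`
and generate strings of length `2i + 1` under `ad f`; `⟨e^i x, y⟩ = (-1)^i ⟨x, e^i y⟩`.  THEOREMS ONLY (no definition,
no named fact, no `sorry`; D-0026 net debt `0`), in the vocabulary of A1-84/A1-88 (`adDegree`, `degreeSpace`,
`IsZGrading`, `IsSl2Triple`), A1-149 (`degreeComponent`) and the tree's `Literature.LinearAlgebra.cyclicSubspace`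
("monic `K[e]`-module" = `cyclicSubspace e v = ⊤`); the commutator Lie ring on `𝔤𝔩(M)` is Mathlib's reducible
non-instance `LieRing.ofAssociativeRing`, enabled FILE-LOCALLY as in the whole series.

## Source, VERBATIM

E. Looijenga, V. A. Lunts, *A Lie algebra attached to a projective variety*, Invent. Math. **129** (1997) 361–412
(held TeX text `paper:arxiv-alg-geom_9604014`), Appendix "a property of the orthogonal and symplectic Lie algebra's",
p0028 L14–L40:

> "As before, `V(d)` denotes the standard irreducible `𝔰𝔩₂`-module of dimension `d+1` […].
> **Lemma.** The decomposition of `𝔤𝔩(V(d))` into irreducible `𝔰𝔩₂`-submodules is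
> `𝔤𝔩(V(d)) = ⊕_{i=0}^{d-1} 𝔤𝔩^{(i)}(V(d))`, where `𝔤𝔩^{(i)}(V(d))` is the `𝔰𝔩₂`-submodule generated by `e^i`.
> Furthermore, `𝔤𝔩^{(0)}(V(d))` consists of the scalars, `𝔤𝔩^{(1)}(V(d))` can be identified with the image of `𝔰𝔩₂`
> in `𝔤𝔩(V(d))` and `𝔤𝔩^{(odd)}(V(d)) = 𝔞𝔲𝔱(V(d))`.
> *Proof.* Let `W` be an irreducible `𝔰𝔩₂`-submodule of `𝔤𝔩(V(d))` of dimension `m+1`. If `T ∈ W` is a highest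
> weight vector, then `[e, T] = 0` and `[h, T] = mT`. Since `V(d)` is a monic `ℂ[e]`-module, it follows that `T` is a
> polynomial in `e` (of degree `≤ d`, of course). Since `[h, e^i] = 2i e^i` it follows that `m` is even and that `T`
> is proportional to `e^{m/2}`. On the other hand is clear that for `i = 0, …, m`, `e^i` is coprimitive of weight
> `2i` and hence generates an irreducible `𝔰𝔩₂`-submodule of `𝔤𝔩(V(d))` of dimension `2i+1`. This proves the first
> part of the lemma. The identity `⟨e^i x, y⟩ = (-)^i ⟨x, e^i y⟩` shows that `e^i ∈ 𝔞𝔲𝔱(V(d))` if and only if `i` is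
> odd."

(The printed upper limit `d - 1` of the sum is a misprint for `d`: `Σ_{i=0}^{d} (2i+1) = (d+1)² = dim 𝔤𝔩(V(d))` and
`e^d ≠ 0` on `V(d)`; nothing below depends on it.)

## Contents (all proved; `K` a field of characteristic `0`, `M` finite-dimensional)

* §1 `mul_mem_adDegree` (`𝔤𝔩_a · 𝔤𝔩_b ⊆ 𝔤𝔩_{a+b}` for the grading by `ad h`), **`pow_mem_degreeSpace_ad`** ("`[h, e^i] =
  2i e^i`"), `lie_pow_self_eq_zero` (`[e, e^i] = 0`), `degreeComponent_ad_aeval` (the component of horizontal degree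
  `2i` of a polynomial `p(e)` is `p_i e^i`) and `degreeComponent_ad_aeval_eq_zero` (no components of other degrees).
* §2 "Since `V(d)` is a monic `K[e]`-module … `T` is proportional to `e^{m/2}`": for `e` CYCLIC on `M`
  (`cyclicSubspace e v = ⊤`, the tree's `exists_eq_aeval_of_commute_of_cyclicSubspace_eq_top`) and `T` commuting with
  `e`: **`exists_eq_smul_pow_of_commute_of_mem_adDegree`** (`[h, T] = 2i T ⟹ T = c e^i`) and
  **`eq_zero_of_commute_of_mem_adDegree`** (`[h, T] = m T` with `m ∉ 2ℕ ⟹ T = 0`: "`m` is even").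
* §3 "`e^i` is coprimitive of weight `2i` and hence generates an irreducible `𝔰𝔩₂`-submodule … of dimension `2i+1`":
  for an `𝔰𝔩₂`-triple `(e, h, f)` of `𝔤𝔩(M)` and `e^i ≠ 0`, **`hasPrimitiveVectorWith_pow`** (`e^i` is a
  primitive = highest weight vector of weight `2i` for the adjoint action, Mathlib `IsSl2Triple.HasPrimitiveVectorWith`),
  hence `ad_pow_apply_pow_ne_zero` (`(ad f)^j e^i ≠ 0` for `j ≤ 2i`) and `ad_pow_apply_pow_eq_zero`
  (`(ad f)^{2i+1} e^i = 0`) — the string of length `2i + 1` (Mathlib `pow_toEnd_f_ne_zero_of_eq_nat` /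
  `pow_toEnd_f_eq_zero_of_eq_nat`); `pow_apply_ne_zero_of_lt_finrank` (`e^i v ≠ 0`, hence `e^i ≠ 0`, for `i ≤ d` when
  `v` is a cyclic vector of the nilpotent `e` on `V(d)`, `dim = d + 1`).
* §4 "The identity `⟨e^i x, y⟩ = (-)^i ⟨x, e^i y⟩`" is the tree's `apply_pow_pow_eq_of_isSkewAdjoint`
  (`LefschetzStringInvariantForm`, A1-123, the case `j = 0`) for `e` skew-adjoint; from it
  **`isSkewAdjoint_pow_of_odd`** (`e^i ∈ 𝔞𝔲𝔱` for odd `i`), `isSelfAdjoint_pow_of_even`.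

## SCOPE

(a) The module-theoretic packaging of the Lemma — the `𝔰𝔩₂`-submodules `𝔤𝔩^{(i)}(V(d))`, their irreducibility and the
direct sum decomposition `𝔤𝔩(V(d)) = ⊕_{i=0}^{d} 𝔤𝔩^{(i)}(V(d))` (complete reducibility + the dimension count), and
`𝔤𝔩^{(odd)} = 𝔞𝔲𝔱(V(d))` as an equality of subspaces — is NOT formalised here; this file provides the two
ingredients the printed proof names (highest weight vectors are the `e^i`; `e^i` heads a string of length `2i+1`).
(b) The rest of the Appendix (Dynkin's theorems, Theorem (7.3)) is out of scope.  (c) Nothing here concerns complex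
tori or the Hodge conjecture.

## References

* [LooijengaLunts1997] E. Looijenga, V. A. Lunts, *A Lie algebra attached to a projective variety*, Invent. Math. 129
  (1997) 361–412; arXiv:alg-geom/9604014. Appendix, Lemma (7.1), p. 28 L14–L40 of the held TeX text; §1 (1.15)
  proof, p. 8 ("any `K[e]`-linear homomorphism `V(n) ≅ K[e]/(e^{n+1})[n] → … ` of degree two").
* [Jacobson] N. Jacobson, *Lectures in Abstract Algebra II*, Ch. III §15 Theorem 17, Corollary — via the tree's
  `Literature.LinearAlgebra.EndomorphismBicommutant` (`exists_eq_aeval_of_commute_of_cyclicSubspace_eq_top`).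
-/

namespace Literature.Algebra.Lie

open Module Function Set LieAlgebra Polynomial

attribute [local instance 100] LieRing.ofAssociativeRing

section Powers

variable {K : Type*} [Field K] [CharZero K] {M : Type*} [AddCommGroup M] [Module K M] [FiniteDimensional K M]
  {h e : Module.End K M}

omit [CharZero K] [FiniteDimensional K M] in
/-- `𝔤𝔩(M)_a · 𝔤𝔩(M)_b ⊆ 𝔤𝔩(M)_{a+b}` for the grading of `𝔤𝔩(M)` by `ad h` (`[h, xy] = [h, x] y + x [h, y]`).
[cite: LooijengaLunts1997, Appendix Lemma (7.1) proof, p. 28 L35 ("[h, e^i] = 2i e^i")] -/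
theorem mul_mem_adDegree {x y : Module.End K M} {a b : K} (hx : x ∈ adDegree K h a) (hy : y ∈ adDegree K h b) :
    x * y ∈ adDegree K h (a + b) := by
  rw [mem_adDegree_iff, Ring.lie_def] at hx hy ⊢
  have e1 : h * (x * y) - x * y * h = (h * x - x * h) * y + x * (h * y - y * h) := by
    simp only [sub_mul, mul_sub, ← mul_assoc]; abel
  rw [e1, hx, hy, smul_mul_assoc, mul_smul_comm, add_smul]

omit [CharZero K] [FiniteDimensional K M] in
/-- **"`[h, e^i] = 2i e^i`"**: the powers of an operator of degree `2` are homogeneous, `e^i ∈ 𝔤𝔩(M)_{2i}(ad h)`.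
[cite: LooijengaLunts1997, Appendix Lemma (7.1) proof, p. 28 L35] -/
theorem pow_mem_degreeSpace_ad (he : e ∈ adDegree K h 2) (i : ℕ) :
    e ^ i ∈ degreeSpace (LieAlgebra.ad K (Module.End K M) h) (2 * (i : ℤ)) := by
  rw [degreeSpace_ad_eq_adDegree]
  induction i with
  | zero =>
    rw [pow_zero, mem_adDegree_iff, Ring.lie_def, mul_one, one_mul, sub_self]
    simp
  | succ i ih =>
    rw [pow_succ]
    have h1 := mul_mem_adDegree ih he
    push_cast at h1 ⊢
    rw [show (2 : K) * ((i : K) + 1) = 2 * (i : K) + 2 by ring]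
    exact h1

omit [CharZero K] [FiniteDimensional K M] in
/-- `[e, e^i] = 0`. [cite: LooijengaLunts1997, Appendix Lemma (7.1) proof, p. 28 L36–L37 ("e^i is coprimitive")] -/
theorem lie_pow_self_eq_zero (e : Module.End K M) (i : ℕ) : ⁅e, e ^ i⁆ = 0 := by
  rw [Ring.lie_def, ← pow_succ', ← pow_succ, sub_self]

/-- **The homogeneous components of a polynomial in `e`**: the component of `p(e) = Σ_i p_i e^i` of degree `2i` under
`ad h` is `p_i e^i` ("Since `[h, e^i] = 2i e^i` …"). [cite: LooijengaLunts1997, Appendix Lemma (7.1) proof, p. 28 L33–L36] -/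
theorem degreeComponent_ad_aeval (he : e ∈ adDegree K h 2) (p : K[X]) (i : ℕ) :
    degreeComponent (LieAlgebra.ad K (Module.End K M) h) (2 * (i : ℤ)) (aeval e p) = p.coeff i • e ^ i := by
  rw [aeval_eq_sum_range, map_sum]
  have hterm : ∀ j : ℕ, degreeComponent (LieAlgebra.ad K (Module.End K M) h) (2 * (i : ℤ)) (p.coeff j • e ^ j) =
      if j = i then p.coeff i • e ^ i else 0 := by
    intro j
    rw [map_smul, degreeComponent_spec _ _ _ _ (pow_mem_degreeSpace_ad he j)]
    by_cases hji : j = i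
    · rw [if_pos (by rw [hji]), if_pos hji, hji]
    · rw [if_neg (fun h ↦ hji (by exact_mod_cast (mul_right_injective₀ (two_ne_zero (α := ℤ))) h)), if_neg hji,
        smul_zero]
  simp_rw [hterm]
  rw [Finset.sum_ite_eq' (Finset.range (p.natDegree + 1)) i]
  split_ifs with hi
  · rfl
  · rw [Finset.mem_range, not_lt] at hi
    rw [coeff_eq_zero_of_natDegree_lt (by omega), zero_smul]

/-- … and a polynomial in `e` has no components of degrees outside `2ℕ` ("it follows that `m` is even").
[cite: LooijengaLunts1997, Appendix Lemma (7.1) proof, p. 28 L33–L36] -/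
theorem degreeComponent_ad_aeval_eq_zero (he : e ∈ adDegree K h 2) (p : K[X]) {m : ℤ}
    (hm : ∀ i : ℕ, 2 * (i : ℤ) ≠ m) :
    degreeComponent (LieAlgebra.ad K (Module.End K M) h) m (aeval e p) = 0 := by
  rw [aeval_eq_sum_range, map_sum]
  refine Finset.sum_eq_zero fun j _ ↦ ?_
  rw [map_smul, degreeComponent_apply_of_mem_ne (pow_mem_degreeSpace_ad he j) (hm j), smul_zero]

end Powers

/-! ### §2 "Since `V(d)` is a monic `K[e]`-module, … `T` is proportional to `e^{m/2}`" -/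

section Cyclic

variable {K : Type*} [Field K] [CharZero K] {M : Type*} [AddCommGroup M] [Module K M] [FiniteDimensional K M]
  {h e : Module.End K M}

/-- **LOOIJENGA–LUNTS, Appendix Lemma (7.1), the key step**: let `e` be CYCLIC on `M` ("`V(d)` is a monic
`K[e]`-module": `M = K[e] v`, the tree's `cyclicSubspace e v = ⊤`), of degree `2` for `h`.  If `T`
commutes with `e` (`[e, T] = 0`) and `[h, T] = 2i T`, then `T` is proportional to `e^i` — "it follows that `T` is a
polynomial in `e` … Since `[h, e^i] = 2i e^i` it follows … that `T` is proportional to `e^{m/2}`" (`m = 2i`).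
[cite: LooijengaLunts1997, Appendix Lemma (7.1) proof, p. 28 L32–L36] [cite: Jacobson, Ch. III §15 Theorem 17, Corollary] -/
theorem exists_eq_smul_pow_of_commute_of_mem_adDegree (he : e ∈ adDegree K h 2) {v : M}
    (hcyc : Literature.LinearAlgebra.cyclicSubspace e v = ⊤) {T : Module.End K M} (hT : T * e = e * T) {i : ℕ}
    (hTi : T ∈ adDegree K h (2 * (i : K))) : ∃ c : K, T = c • e ^ i := by
  obtain ⟨p, rfl⟩ := Literature.LinearAlgebra.exists_eq_aeval_of_commute_of_cyclicSubspace_eq_top hcyc hT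
  refine ⟨p.coeff i, ?_⟩
  have h1 : aeval e p ∈ degreeSpace (LieAlgebra.ad K (Module.End K M) h) (2 * (i : ℤ)) := by
    rw [degreeSpace_ad_eq_adDegree]; push_cast; exact hTi
  rw [← degreeComponent_ad_aeval he p i, degreeComponent_apply_of_mem h1]

/-- … and "**`m` is even**" (and non-negative): if `T` commutes with the cyclic `e` and `[h, T] = m T` with
`m ∉ {0, 2, 4, …}`, then `T = 0`. [cite: LooijengaLunts1997, Appendix Lemma (7.1) proof, p. 28 L32–L36] -/
theorem eq_zero_of_commute_of_mem_adDegree (he : e ∈ adDegree K h 2) {v : M}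
    (hcyc : Literature.LinearAlgebra.cyclicSubspace e v = ⊤) {T : Module.End K M} (hT : T * e = e * T) {m : ℤ}
    (hm : ∀ i : ℕ, 2 * (i : ℤ) ≠ m) (hTm : T ∈ adDegree K h (m : K)) : T = 0 := by
  obtain ⟨p, rfl⟩ := Literature.LinearAlgebra.exists_eq_aeval_of_commute_of_cyclicSubspace_eq_top hcyc hT
  have h1 : aeval e p ∈ degreeSpace (LieAlgebra.ad K (Module.End K M) h) m := by
    rw [degreeSpace_ad_eq_adDegree]; exact hTm
  rw [← degreeComponent_apply_of_mem h1, degreeComponent_ad_aeval_eq_zero he p hm]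

omit [CharZero K] in
/-- The powers `e^i v`, `i < dim M`, of a cyclic vector `v` are non-zero (so `e^i ≠ 0` for `i ≤ d` on `V(d)`,
`dim V(d) = d + 1`: "of degree `≤ d`, of course"). [cite: LooijengaLunts1997, Appendix Lemma (7.1) proof, p. 28 L33–L34] -/
theorem pow_apply_ne_zero_of_lt_finrank {v : M} (hcyc : Literature.LinearAlgebra.cyclicSubspace e v = ⊤) {i : ℕ}
    (hi : i < finrank K M) : (e ^ i) v ≠ 0 := by
  intro h0
  -- `M = K[e] v` is spanned by `v, e v, …, e^{i-1} v`, of dimension `≤ i < dim M`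
  have hle : Literature.LinearAlgebra.cyclicSubspace e v ≤
      Submodule.span K (Set.range fun n : Fin i ↦ (e ^ (n : ℕ)) v) := by
    rw [Literature.LinearAlgebra.cyclicSubspace_eq_span, Submodule.span_le]
    rintro _ ⟨n, rfl⟩
    show (e ^ n) v ∈ Submodule.span K (Set.range fun n : Fin i ↦ (e ^ (n : ℕ)) v)
    by_cases hn : n < i
    · exact Submodule.subset_span ⟨⟨n, hn⟩, rfl⟩
    · have h1 : (e ^ n) v = 0 := by
        rw [show n = (n - i) + i by omega, pow_add, Module.End.mul_apply, h0, map_zero]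
      rw [h1]
      exact Submodule.zero_mem _
  have h2 := Submodule.finrank_mono hle
  rw [hcyc, finrank_top] at h2
  have h3 : finrank K (Submodule.span K (Set.range fun n : Fin i ↦ (e ^ (n : ℕ)) v)) ≤ i :=
    (finrank_range_le_card (R := K) fun n : Fin i ↦ (e ^ (n : ℕ)) v).trans_eq (Fintype.card_fin i)
  omega

omit [CharZero K] in
/-- … hence `e^i ≠ 0` for `i < dim M`. [cite: LooijengaLunts1997, Appendix Lemma (7.1) proof, p. 28 L33–L34] -/
theorem pow_ne_zero_of_lt_finrank {v : M} (hcyc : Literature.LinearAlgebra.cyclicSubspace e v = ⊤) {i : ℕ}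
    (hi : i < finrank K M) : e ^ i ≠ 0 := fun h0 ↦
  pow_apply_ne_zero_of_lt_finrank hcyc hi (by rw [h0, LinearMap.zero_apply])

end Cyclic

/-! ### §3 "`e^i` is coprimitive of weight `2i` and hence generates an irreducible `𝔰𝔩₂`-submodule of dimension `2i+1`" -/

section Coprimitive

variable {K : Type*} [Field K] [CharZero K] {M : Type*} [AddCommGroup M] [Module K M] [FiniteDimensional K M]
  {h e f : Module.End K M}

omit [CharZero K] [FiniteDimensional K M] in
/-- **`e^i` is a highest weight ("coprimitive") vector of weight `2i`** for the adjoint action of an `𝔰𝔩₂`-triple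
`(e, h, f)` of `𝔤𝔩(M)` on `𝔤𝔩(M)`: `[h, e^i] = 2i e^i`, `[e, e^i] = 0` (Mathlib `IsSl2Triple.HasPrimitiveVectorWith`, for
`e^i ≠ 0`). [cite: LooijengaLunts1997, Appendix Lemma (7.1) proof, p. 28 L36–L38] -/
theorem hasPrimitiveVectorWith_pow (t : IsSl2Triple h e f) {i : ℕ} (hi : e ^ i ≠ 0) :
    t.HasPrimitiveVectorWith (e ^ i) (2 * (i : K)) where
  ne_zero := hi
  lie_h := by
    have h1 := pow_mem_degreeSpace_ad (e_mem_adDegree t) i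
    rw [degreeSpace_ad_eq_adDegree, mem_adDegree_iff] at h1
    push_cast at h1
    exact h1
  lie_e := lie_pow_self_eq_zero e i

omit [FiniteDimensional K M] in
/-- **The string through `e^i` has length `2i + 1`**: `(ad f)^j (e^i) ≠ 0` for `j ≤ 2i` … (Mathlib
`IsSl2Triple.HasPrimitiveVectorWith.pow_toEnd_f_ne_zero_of_eq_nat`; "generates an irreducible `𝔰𝔩₂`-submodule of
`𝔤𝔩(V(d))` of dimension `2i+1`"). [cite: LooijengaLunts1997, Appendix Lemma (7.1) proof, p. 28 L36–L38] -/
theorem ad_pow_apply_pow_ne_zero (t : IsSl2Triple h e f) {i : ℕ} (hi : e ^ i ≠ 0) {j : ℕ}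
    (hj : j ≤ 2 * i) : ((LieAlgebra.ad K (Module.End K M) f) ^ j) (e ^ i) ≠ 0 :=
  (hasPrimitiveVectorWith_pow t hi).pow_toEnd_f_ne_zero_of_eq_nat (n := 2 * i) (by push_cast; ring) hj

/-- … and `(ad f)^{2i+1} (e^i) = 0`. [cite: LooijengaLunts1997, Appendix Lemma (7.1) proof, p. 28 L36–L38] -/
theorem ad_pow_apply_pow_eq_zero (t : IsSl2Triple h e f) {i : ℕ} (hi : e ^ i ≠ 0) :
    ((LieAlgebra.ad K (Module.End K M) f) ^ (2 * i + 1)) (e ^ i) = 0 :=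
  (hasPrimitiveVectorWith_pow t hi).pow_toEnd_f_eq_zero_of_eq_nat (n := 2 * i) (by push_cast; ring)

omit [CharZero K] [FiniteDimensional K M] in
/-- The members of the string are weight vectors: `[h, (ad f)^j e^i] = (2i - 2j) (ad f)^j e^i`.
[cite: LooijengaLunts1997, Appendix Lemma (7.1) proof, p. 28 L36–L38] -/
theorem lie_h_ad_pow_apply_pow (t : IsSl2Triple h e f) {i : ℕ} (hi : e ^ i ≠ 0) (j : ℕ) :
    ⁅h, ((LieAlgebra.ad K (Module.End K M) f) ^ j) (e ^ i)⁆ =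
      (2 * (i : K) - 2 * j) • ((LieAlgebra.ad K (Module.End K M) f) ^ j) (e ^ i) :=
  (hasPrimitiveVectorWith_pow t hi).lie_h_pow_toEnd_f j

omit [CharZero K] [FiniteDimensional K M] in
/-- "`𝔤𝔩^{(0)}(V(d))` consists of the scalars": the string through `e^0 = 1` is `{1}` — `(ad f) 1 = 0`.
[cite: LooijengaLunts1997, Appendix Lemma (7.1), p. 28 L23] -/
theorem ad_apply_one_eq_zero (f : Module.End K M) : (LieAlgebra.ad K (Module.End K M) f) 1 = 0 := by
  rw [LieAlgebra.ad_apply, Ring.lie_def, mul_one, one_mul, sub_self]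

omit [CharZero K] [FiniteDimensional K M] in
/-- "`𝔤𝔩^{(1)}(V(d))` can be identified with the image of `𝔰𝔩₂`": the string through `e^1 = e` is `e, -h, -2f` —
`(ad f) e = -h` and `(ad f)² e = -2f` — so it spans `Ke + Kh + Kf`, the image of `𝔰𝔩₂` (Mathlib
`IsSl2Triple.toLieSubalgebra = span {e, f, h}`). [cite: LooijengaLunts1997, Appendix Lemma (7.1), p. 28 L23–L24] -/
theorem ad_f_apply_e_and_sq (t : IsSl2Triple h e f) :
    (LieAlgebra.ad K (Module.End K M) f) e = -h ∧ ((LieAlgebra.ad K (Module.End K M) f) ^ 2) e = -((2 : K) • f) := by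
  have h1 : (LieAlgebra.ad K (Module.End K M) f) e = -h := by
    rw [LieAlgebra.ad_apply, ← lie_skew, t.lie_e_f]
  refine ⟨h1, ?_⟩
  rw [pow_two, Module.End.mul_apply, h1, LieAlgebra.ad_apply, lie_neg, ← lie_skew, t.lie_lie_smul_f K, neg_neg]

omit [FiniteDimensional K M] in
/-- … so the span of the string through `e` is the underlying subspace `Ke + Kf + Kh` of the image of `𝔰𝔩₂`.
[cite: LooijengaLunts1997, Appendix Lemma (7.1), p. 28 L23–L24] -/
theorem span_string_e_eq (t : IsSl2Triple h e f) :
    Submodule.span K {e, (LieAlgebra.ad K (Module.End K M) f) e, ((LieAlgebra.ad K (Module.End K M) f) ^ 2) e} =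
      Submodule.span K ({e, f, h} : Set (Module.End K M)) := by
  obtain ⟨h1, h2⟩ := ad_f_apply_e_and_sq t
  rw [h1, h2]
  refine le_antisymm (Submodule.span_le.2 fun x hx ↦ ?_) (Submodule.span_le.2 fun x hx ↦ ?_)
  · have hE : e ∈ Submodule.span K ({e, f, h} : Set (Module.End K M)) := Submodule.subset_span (by simp)
    have hF : f ∈ Submodule.span K ({e, f, h} : Set (Module.End K M)) := Submodule.subset_span (by simp)
    have hH : h ∈ Submodule.span K ({e, f, h} : Set (Module.End K M)) := Submodule.subset_span (by simp)
    simp only [Set.mem_insert_iff, Set.mem_singleton_iff] at hx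
    rcases hx with hx | hx | hx <;> rw [SetLike.mem_coe, hx]
    · exact hE
    · exact Submodule.neg_mem _ hH
    · exact Submodule.neg_mem _ (Submodule.smul_mem _ _ hF)
  · have hE : e ∈ Submodule.span K ({e, -h, -((2 : K) • f)} : Set (Module.End K M)) := Submodule.subset_span (by simp)
    have hH : -h ∈ Submodule.span K ({e, -h, -((2 : K) • f)} : Set (Module.End K M)) := Submodule.subset_span (by simp)
    have hF : -((2 : K) • f) ∈ Submodule.span K ({e, -h, -((2 : K) • f)} : Set (Module.End K M)) :=
      Submodule.subset_span (by simp)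
    simp only [Set.mem_insert_iff, Set.mem_singleton_iff] at hx
    rcases hx with hx | hx | hx <;> rw [SetLike.mem_coe, hx]
    · exact hE
    · have h4 : (-(2 : K)⁻¹) • (-((2 : K) • f)) = f := by
        rw [neg_smul, smul_neg, neg_neg, smul_smul, inv_mul_cancel₀ two_ne_zero, one_smul]
      have h5 := Submodule.smul_mem _ (-(2 : K)⁻¹) hF
      rwa [h4] at h5
    · have h5 := Submodule.neg_mem _ hH
      rwa [neg_neg] at h5

end Coprimitive

/-! ### §4 "The identity `⟨e^i x, y⟩ = (-)^i ⟨x, e^i y⟩`" -/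

section Form

variable {K : Type*} [Field K] {M : Type*} [AddCommGroup M] [Module K M] {B : LinearMap.BilinForm K M}
  {e : Module.End K M}

/-- … so **`e^i ∈ 𝔞𝔲𝔱(V(d))` for odd `i`** ("`e^i ∈ 𝔞𝔲𝔱(V(d))` if and only if `i` is odd").
[cite: LooijengaLunts1997, Appendix Lemma (7.1), p. 28 L24, L38–L40] -/
theorem isSkewAdjoint_pow_of_odd (he : B.IsSkewAdjoint e) {i : ℕ} (hi : Odd i) : B.IsSkewAdjoint ⇑(e ^ i) := by
  intro x y
  -- `⟨e^i x, y⟩ = (-1)^i ⟨x, e^i y⟩` (the tree's `apply_pow_pow_eq_of_isSkewAdjoint`, `j = 0`)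
  have h1 : B ((e ^ i) x) y = (-1 : K) ^ i * B x ((e ^ i) y) := by
    simpa using apply_pow_pow_eq_of_isSkewAdjoint he x y i 0
  rw [Pi.neg_apply, map_neg, h1, hi.neg_one_pow, neg_one_mul]

/-- … and `e^i` is SELF-adjoint for even `i` (so, for `⟨ , ⟩` non-degenerate and `e^i ≠ 0`, not in `𝔞𝔲𝔱`: the "only if").
[cite: LooijengaLunts1997, Appendix Lemma (7.1), p. 28 L24, L38–L40] -/
theorem isSelfAdjoint_pow_of_even (he : B.IsSkewAdjoint e) {i : ℕ} (hi : Even i) : B.IsSelfAdjoint ⇑(e ^ i) := by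
  intro x y
  have h1 : B ((e ^ i) x) y = (-1 : K) ^ i * B x ((e ^ i) y) := by
    simpa using apply_pow_pow_eq_of_isSkewAdjoint he x y i 0
  rw [h1, hi.neg_one_pow, one_mul]

/-- The "only if": a non-zero operator cannot be both self- and skew-adjoint for a form with trivial left kernel
(characteristic `≠ 2`), so for even `i` with `e^i ≠ 0`, `e^i ∉ 𝔞𝔲𝔱(V(d))`. [cite: LooijengaLunts1997, Appendix Lemma (7.1), p. 28 L24, L38–L40] -/
theorem not_isSkewAdjoint_pow_of_even [CharZero K] (hB : B.SeparatingLeft) (he : B.IsSkewAdjoint e) {i : ℕ}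
    (hi : Even i) (hne : e ^ i ≠ 0) : ¬B.IsSkewAdjoint ⇑(e ^ i) := by
  intro hsk
  apply hne
  ext x
  rw [LinearMap.zero_apply]
  refine hB _ fun y ↦ ?_
  have h1 := isSelfAdjoint_pow_of_even he hi x y
  have h2 := hsk x y
  rw [Pi.neg_apply, map_neg, h1] at h2
  -- `B x (e^i y) = -B x (e^i y)`
  have h3 : B ((e ^ i) x) y = 0 := by
    rw [h1]
    have h4 : (2 : K) * B x ((e ^ i) y) = 0 := by rw [two_mul]; nth_rw 1 [h2]; rw [neg_add_cancel]
    exact (mul_eq_zero.1 h4).resolve_left two_ne_zero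
  exact h3

end Form

end Literature.Algebra.Lie
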